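import Summits.CriticalPhenomena.CardyFormulaZ2.Theses.CardyMagicRigidity
import Literature.Probability.Percolation.PlateCrossingEvents
import Literature.Probability.Percolation.OrbitLoopArcs
import Literature.Probability.Percolation.OrbitLoopSides
import Literature.Probability.Percolation.LatticeShadowOfPath
import Literature.Probability.Percolation.InterfaceLoopSeparation
import Literature.Probability.Percolation.ClusterOuterBoundary
import Literature.Topology.PlaneTopology.JordanLoopRectangleCrossing
import Literature.Topology.PlaneTopology.StripCrossings
import Literature.Probability.Percolation.FourArmGarbanCrossingEvent

/-!
# Stub C-T2a of line `oracle-sandwich` (crux `LoopsToCrossings`): a medial loop arc between a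
# primal and a dual horizontal plate crossing

`stub_zdLoopArc`: if `ω ⊆ E(ℤ²)` (window: no primal arm from `B̄(0,W₀)` to distance `W₁`) has
a primal-open AND a dual-open horizontal crossing of the plate `Φ(plateBox xout y)` between the
zones `Φ{re ≤ -xin}`, `Φ{xin ≤ re}`, then some interface loop `γ` of `ω` with trace in
`B(0, W₁+1)` has a based representative `α` (`CurveClass.mk α = loopCurve δ 0 γ`) and a parameter
interval `[s, t]` whose image lies in `Φ(plateBox xin (y + c/2))` and meets `Φ{re ≤ -(xin-c/2)}`
and `Φ{xin-c/2 ≤ re}`.  Proof = the chain of Literature lemmas named in the docstring of the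
registered stub: separation by winding counting (`exists_orbitLoop_wind_ne_of_path`) along the
lattice shadow of a chart segment between a middle site of the primal walk and a middle face of
the dual walk, sides of the rounded Jordan loop (`OrbitLoopSides`), the Jordan/rectangle crossing
lemma in the chart (`IsJordanLoop.exists_isPreconnected_crossing_of_separated`), and the passage
from the connected crossing piece to an arc of the medial polygon (`exists_arc_of_run`).
-/

noncomputable section

namespace Summit.CriticalPhenomena.CardyFormulaZ2.Cruxes.LoopsToCrossings.OracleSandwich

open Literature.Probability.RandomPlanarGeometry
open Literature.Probability.Percolation
open Literature.Probability.LatticeModels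
open Literature.Topology.PlaneTopology
open Filter Topology Set MeasureTheory Metric Complex Function

/-- A non-trivial walk has an edge at its start. [folklore] -/
theorem exists_edge_at_start {a b : Site 2} (W : (zdGraph 2).Walk a b) (hab : a ≠ b) :
    ∃ y, s(a, y) ∈ W.edges := by
  cases W with
  | nil => exact absurd rfl hab
  | cons h W' => exact ⟨_, by rw [SimpleGraph.Walk.edges_cons]; exact List.mem_cons.2 (Or.inl rfl)⟩

/-- **Stub C-T2a** (registered statement; see the module docstring). [folklore] -/
theorem stub_zdLoopArc :
    ∀ (Φ : ℂ ≃ₜ ℂ) (c : ℝ), 0 < c → ∃ δ₀ : ℝ, 0 < δ₀ ∧ ∀ δ : ℝ, 0 < δ → δ ≤ δ₀ →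
      ∀ (W₀ W₁ : ℝ), Φ '' plateBox 2 2 ⊆ ball (0 : ℂ) W₀ → W₀ < W₁ →
      ∀ (xin xout y : ℝ), 2 * c ≤ xin → xin ≤ xout → xout ≤ 2 → c ≤ y → y + c ≤ 2 →
      ∀ ω : BondConfig (Site 2), ω ⊆ (zdGraph 2).edgeSet →
        (ω ∉ annulusOpenCrossing 0 δ W₀ W₁ ∧ ω ∉ annulusDualCrossing 0 δ W₀ W₁) →
        ω ∈ zdPlateH (meshPoint δ) Φ xin xout y → dualConfig ω ∈ zdPlateH (dualDraw δ) Φ xin xout y →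
        ∃ γ : List MedialVertex, IsInterfaceLoop ω γ ∧
          (loopCurve δ 0 γ).range ⊆ ball (0 : ℂ) (W₁ + 1) ∧
          ∃ (α : Curve ℂ) (s t : unitInterval), CurveClass.mk α = loopCurve δ 0 γ ∧ s ≤ t ∧
            (∀ u ∈ Icc s t, α u ∈ Φ '' plateBox xin (y + c / 2)) ∧
            (∃ u ∈ Icc s t, α u ∈ Φ '' {z : ℂ | z.re ≤ -(xin - c / 2)}) ∧
            (∃ u ∈ Icc s t, α u ∈ Φ '' {z : ℂ | xin - c / 2 ≤ z.re}) := by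
  intro Φ c hc
  -- rooms: `ν = c/16`, chart room `ρ`, meshes `δ ≤ ρ/4`
  have hν : 0 < c / 16 := by positivity
  obtain ⟨ρ, hρ, hρ1, hroom⟩ := exists_chart_room_symm' Φ hν
  refine ⟨ρ / 4, by positivity, fun δ hδ hδρ ↦ ?_⟩
  intro W₀ W₁ hW hW₀₁ xin xout y hxin hxio hxout hy hy2 ω hωE hwin hHp hHd
  obtain ⟨hwinP, -⟩ := hwin
  set ν := c / 16 with hνdef
  set a₀ := xin - c / 4 with ha₀
  set b₀ := y + c / 4 with hb₀
  have ha₀pos : 0 < a₀ := by linarith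
  have hδρ' : δ ≤ ρ := by linarith
  have h2δρ : 2 * δ ≤ ρ := by linarith
  have hxout2 : xout ≤ 2 := hxout
  have hy2' : y ≤ 2 := by linarith
  -- chart readings of sites / faces
  let φP : Site 2 → ℝ := fun x ↦ (Φ.symm (meshPoint δ x)).re
  let φD : Site 2 → ℝ := fun f ↦ (Φ.symm (dualDraw δ f)).re
  ------------------------------------------------------------------
  -- Step 1: the primal and the dual horizontal plate walks
  ------------------------------------------------------------------
  rw [zdPlateH, mem_openCrossing_iff] at hHp hHd
  obtain ⟨uP, huP, vP, hvP, hconnP⟩ := hHp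
  obtain ⟨fD, hfD, gDend, hgDend, hconnD⟩ := hHd
  obtain ⟨P, hPS, hPω⟩ := exists_walk_of_mem_openConnIn hωE hconnP
  obtain ⟨D, hDS, hDω⟩ := exists_walk_of_mem_openConnIn
    (fun _ h ↦ h.1 : dualConfig ω ⊆ (zdGraph 2).edgeSet) hconnD
  have huP' : φP uP ≤ -xin := (symm_mem_of_mem_image huP : _)
  have hvP' : xin ≤ φP vP := (symm_mem_of_mem_image hvP : _)
  have hfD' : φD fD ≤ -xin := (symm_mem_of_mem_image hfD : _)
  have hgDend' : xin ≤ φD gDend := (symm_mem_of_mem_image hgDend : _)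
  have hxin0 : 0 < xin := by linarith
  have huv : uP ≠ vP := by intro h; rw [h] at huP'; linarith
  have hfg : fD ≠ gDend := by intro h; rw [h] at hfD'; linarith
  -- plate boxes of the supports
  have hPbox : ∀ x ∈ P.support, meshPoint δ x ∈ Φ '' plateBox xout y := hPS
  have hDbox : ∀ f ∈ D.support, dualDraw δ f ∈ Φ '' plateBox xout y := hDS
  ------------------------------------------------------------------
  -- Step 2: a middle site `xP` of `P` and a middle face `gF` of `D`
  ------------------------------------------------------------------
  have hνP : ∀ z ∈ P.support, ∀ v : Site 2, (zdGraph 2).Adj v z → |φP v - φP z| ≤ ν := by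
    intro z hz v hvz
    have hzb := symm_mem_of_mem_image (hPbox z hz)
    have hz2 : Φ.symm (meshPoint δ z) ∈ plateBox 2 2 := plateBox_subset_two hxout2 hy2' hzb
    have hd : dist (meshPoint δ v) (Φ (Φ.symm (meshPoint δ z))) ≤ ρ := by
      rw [Homeomorph.apply_symm_apply, dist_meshPoint_adj hδ hvz]; exact hδρ'
    exact (chart_coords_near hroom hz2 hd).1
  have hνD : ∀ z ∈ D.support, ∀ v : Site 2, (zdGraph 2).Adj v z → |φD v - φD z| ≤ ν := by
    intro z hz v hvz
    have hzb := symm_mem_of_mem_image (hDbox z hz)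
    have hz2 : Φ.symm (dualDraw δ z) ∈ plateBox 2 2 := plateBox_subset_two hxout2 hy2' hzb
    have hd : dist (dualDraw δ v) (Φ (Φ.symm (dualDraw δ z))) ≤ ρ := by
      rw [Homeomorph.apply_symm_apply, dist_dualDraw_adj hδ hvz]; exact hδρ'
    exact (chart_coords_near hroom hz2 hd).1
  obtain ⟨xP, hxP, hxP0, hxPν⟩ := exists_mem_support_small_pos P φP (by linarith) (by linarith) hνP
  obtain ⟨gF, hgF, hgF0, hgFν⟩ := exists_mem_support_small_pos D φD (by linarith) (by linarith) hνD
  have hxPbox := symm_mem_of_mem_image (hPbox xP hxP)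
  have hgFbox := symm_mem_of_mem_image (hDbox gF hgF)
  rw [mem_plateBox_iff_abs] at hxPbox hgFbox
  ------------------------------------------------------------------
  -- Step 3: the lattice shadow of the chart segment from the face of `xP` to the face `gF`
  ------------------------------------------------------------------
  let a₁ : ℂ := Φ.symm (dualDraw δ xP)
  let b₁ : ℂ := Φ.symm (dualDraw δ gF)
  -- both chart ends lie in `plateBox (2ν) (y + ν)`
  have ha₁box : |a₁.re| ≤ 2 * ν ∧ |a₁.im| ≤ y + ν := by
    have hz2 : Φ.symm (meshPoint δ xP) ∈ plateBox 2 2 :=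
      plateBox_subset_two hxout2 hy2' (mem_plateBox_iff_abs.2 hxPbox)
    have hd : dist (dualDraw δ xP) (Φ (Φ.symm (meshPoint δ xP))) ≤ ρ := by
      rw [Homeomorph.apply_symm_apply]; exact (dist_dualDraw_meshPoint_le hδ.le xP).trans hδρ'
    have hnear := chart_coords_near hroom hz2 hd
    have h1 : |(Φ.symm (meshPoint δ xP)).re| ≤ ν := by
      show |φP xP| ≤ ν; rw [abs_le]; constructor <;> linarith
    constructor
    · have := abs_sub_abs_le_abs_sub a₁.re (Φ.symm (meshPoint δ xP)).re; linarith [hnear.1]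
    · have := abs_sub_abs_le_abs_sub a₁.im (Φ.symm (meshPoint δ xP)).im; linarith [hnear.2, hxPbox.2]
  have hb₁box : |b₁.re| ≤ 2 * ν ∧ |b₁.im| ≤ y + ν := by
    constructor
    · show |φD gF| ≤ 2 * ν; rw [abs_le]; constructor <;> linarith
    · linarith [hgFbox.2]
  let σ : ℝ → ℂ := fun t ↦ Φ (a₁ + (t : ℂ) * (b₁ - a₁))
  have hσc : Continuous σ := by
    show Continuous (fun t : ℝ ↦ Φ (a₁ + (t : ℂ) * (b₁ - a₁))); fun_prop
  have hconv : ∀ (p₁ p₂ r : ℝ), |p₁| ≤ r → |p₂| ≤ r → ∀ t ∈ Icc (0 : ℝ) 1, |(1 - t) * p₁ + t * p₂| ≤ r := by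
    intro p₁ p₂ r hp₁ hp₂ t ht
    have ht0 : 0 ≤ t := ht.1
    have ht1 : 0 ≤ 1 - t := by linarith [ht.2]
    calc |(1 - t) * p₁ + t * p₂| ≤ |(1 - t) * p₁| + |t * p₂| := abs_add_le _ _
      _ = (1 - t) * |p₁| + t * |p₂| := by rw [abs_mul, abs_mul, abs_of_nonneg ht1, abs_of_nonneg ht0]
      _ ≤ (1 - t) * r + t * r := add_le_add (mul_le_mul_of_nonneg_left hp₁ ht1) (mul_le_mul_of_nonneg_left hp₂ ht0)
      _ = r := by ring
  have hσbox : ∀ t ∈ Icc (0 : ℝ) 1, a₁ + (t : ℂ) * (b₁ - a₁) ∈ plateBox (2 * ν) (y + ν) := by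
    intro t ht
    rw [mem_plateBox_iff_abs]
    have hre : (a₁ + (t : ℂ) * (b₁ - a₁)).re = (1 - t) * a₁.re + t * b₁.re := by simp; ring
    have him : (a₁ + (t : ℂ) * (b₁ - a₁)).im = (1 - t) * a₁.im + t * b₁.im := by simp; ring
    rw [hre, him]
    exact ⟨hconv _ _ _ ha₁box.1 hb₁box.1 t ht, hconv _ _ _ ha₁box.2 hb₁box.2 t ht⟩
  have hσ0 : σ 0 = dualDraw δ xP := by
    show Φ (a₁ + ((0 : ℝ) : ℂ) * (b₁ - a₁)) = dualDraw δ xP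
    rw [Complex.ofReal_zero, zero_mul, add_zero]; exact Φ.apply_symm_apply _
  have hσ1 : σ 1 = dualDraw δ gF := by
    show Φ (a₁ + ((1 : ℝ) : ℂ) * (b₁ - a₁)) = dualDraw δ gF
    rw [Complex.ofReal_one, one_mul, add_sub_cancel]; exact Φ.apply_symm_apply _
  obtain ⟨u₀, w₀, Sh, hu₀, hw₀, hSh⟩ := exists_walk_shadowing_path hδ hσc.continuousOn
  -- the end squares are those of `xP` and `gF`
  have hcenter : ∀ g : Site 2, dualDraw δ g =
      (δ : ℂ) * (((g 0 : ℝ) : ℂ) + 1 / 2) + (δ : ℂ) * (((g 1 : ℝ) : ℂ) + 1 / 2) * Complex.I := by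
    intro g
    simp only [dualDraw, dualScale_apply, dualOffset]
    apply Complex.ext <;> simp <;> ring
  have hu₀eq : xP = u₀ := (eq_of_center_mem_face hδ (by rw [← hcenter, ← hσ0]; exact hu₀)).symm
  have hw₀eq : gF = w₀ := (eq_of_center_mem_face hδ (by rw [← hcenter, ← hσ1]; exact hw₀)).symm
  subst hu₀eq; subst hw₀eq
  -- every site of the shadow is drawn inside `Φ(plateBox 2 2) ⊆ B(0, W₀)`
  have hShbox : ∀ x ∈ Sh.support, ‖meshPoint δ x‖ < W₀ := by
    intro x hx
    obtain ⟨t, ht, hxt⟩ := hSh x hx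
    have hdist : dist (meshPoint δ x) (σ t) ≤ 2 * δ := dist_meshPoint_le_of_mem_face hδ hxt
    have hzt := hσbox t ht
    have hzt2 : a₁ + (t : ℂ) * (b₁ - a₁) ∈ plateBox 2 2 := by
      rw [mem_plateBox_iff_abs] at hzt ⊢; constructor <;> linarith [hzt.1, hzt.2]
    have hnear := chart_coords_near hroom hzt2 (p := meshPoint δ x) (hdist.trans h2δρ)
    have hx2 : Φ.symm (meshPoint δ x) ∈ plateBox 2 2 := by
      rw [mem_plateBox_iff_abs] at hzt ⊢
      constructor
      · have := abs_sub_abs_le_abs_sub (Φ.symm (meshPoint δ x)).re (a₁ + (t : ℂ) * (b₁ - a₁)).re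
        linarith [hnear.1, hzt.1]
      · have := abs_sub_abs_le_abs_sub (Φ.symm (meshPoint δ x)).im (a₁ + (t : ℂ) * (b₁ - a₁)).im
        linarith [hnear.2, hzt.2]
    have : meshPoint δ x ∈ ball (0 : ℂ) W₀ := hW (mem_image_of_symm_mem hx2)
    rwa [mem_ball, dist_zero_right] at this
  -- hence all corners at sites of the shadow are periodic
  have hper : ∀ x ∈ Sh.support, ∀ k' : Fin 4, (x, k') ∈ periodicPts (nextCorner ω) := by
    intro x hx k'
    exact mem_periodicPts_nextCorner_of_finite_openCluster
      (finite_openCluster_of_not_mem_annulusOpenCrossing hωE hδ hW₀₁ hwinP (hShbox x hx).le)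
  obtain ⟨v, d, m, hv0, hvm, hstep, hvsupp⟩ := exists_unitStepPath_of_walk Sh
  ------------------------------------------------------------------
  -- Step 4: separation by winding counting, and the sides of the rounded loop
  ------------------------------------------------------------------
  obtain ⟨q, ⟨j, hj, hqj⟩, hq, hne⟩ := exists_orbitLoop_wind_ne_of_path hstep 0
    (fun j hj k' ↦ hper (v j) (hvsupp j hj) k')
  rw [hv0, hvm, faceAt_zero] at hne
  let L := loopCurve 1 0 (orbitLoop ω q)
  have hil : IsInterfaceLoop ω (orbitLoop ω q) := isInterfaceLoop_orbitLoop hq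
  have hWP : ∀ z ∈ P.support, L.wind (meshPoint 1 z) = L.wind (meshPoint 1 uP) :=
    wind_eq_of_openWalk hil P hPω
  have hWD : ∀ f ∈ D.support, L.wind (faceCenter f) = L.wind (faceCenter fD) :=
    wind_faceCenter_eq_of_dualWalk hil D hDω
  have hneq : L.wind (meshPoint 1 uP) ≠ L.wind (faceCenter fD) := by
    rw [← hWP xP hxP, ← hWD gF hgF]; exact hne
  -- exactly one of the two winding numbers vanishes
  have hcases : (L.wind (meshPoint 1 uP) ≠ 0 ∧ L.wind (faceCenter fD) = 0) ∨
      (L.wind (meshPoint 1 uP) = 0 ∧ L.wind (faceCenter fD) ≠ 0) := by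
    rcases hil.wind_mem_and_loopSignedArea with ⟨hw, -⟩ | ⟨hw, -⟩ <;>
    · rcases hw (meshPoint 1 uP) with h1 | h1 <;> rcases hw (faceCenter fD) with h2 | h2 <;>
        first
        | exact absurd (h1.trans h2.symm) hneq
        | (left; exact ⟨by rw [h1]; norm_num, h2⟩)
        | (right; exact ⟨h1, by rw [h2]; norm_num⟩)
  let Λ := OrbitPolygon.loop ω q δ
  have hΛJ : IsJordanLoop Λ := OrbitPolygon.isJordanLoop_loop hq hδ
  obtain ⟨yP, hyP⟩ := exists_edge_at_start P huv
  obtain ⟨yD, hyD⟩ := exists_edge_at_start D hfg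
  ------------------------------------------------------------------
  -- Step 5: chart continua of the two traces in the rectangle `[-a₀, a₀] × [-b₀, b₀]`
  ------------------------------------------------------------------
  have hPnil : ¬ P.Nil := SimpleGraph.Walk.not_nil_of_ne huv
  have hDnil : ¬ D.Nil := SimpleGraph.Walk.not_nil_of_ne hfg
  let TP : Set ℂ := Φ.symm '' meshTrace δ P
  let TD : Set ℂ := Φ.symm '' (dualScale δ '' walkTrace D)
  have hTPc : IsCompact TP := (isCompact_meshTrace δ P).image Φ.symm.continuous
  have hTDc : IsCompact TD := (isCompact_image_dualScale_walkTrace δ D).image Φ.symm.continuous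
  have hTPconn : IsPreconnected TP := (isPreconnected_meshTrace δ P).image _ Φ.symm.continuous.continuousOn
  have hTDconn : IsPreconnected TD := (isPreconnected_dualTrace δ D).image _ Φ.symm.continuous.continuousOn
  have hTPbox : ∀ z ∈ TP, z ∈ plateBox (xout + ν) (y + ν) := by
    rintro _ ⟨p, hp, rfl⟩; exact symm_meshTrace_subset hδ hδρ' hroom hxout2 hy2' hPbox hp
  have hTDbox : ∀ z ∈ TD, z ∈ plateBox (xout + ν) (y + ν) := by
    rintro _ ⟨p, hp, rfl⟩; exact symm_dualTrace_subset hδ hδρ' hroom hxout2 hy2' hDbox hp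
  -- end points of the traces in the two zones
  have hTPl : ∃ z ∈ TP, z.re ≤ -a₀ :=
    ⟨_, mem_image_of_mem _ (meshPoint_mem_meshTrace_of_mem_support hPnil P.start_mem_support), by
      show φP uP ≤ -a₀; linarith⟩
  have hTPr : ∃ z ∈ TP, a₀ ≤ z.re :=
    ⟨_, mem_image_of_mem _ (meshPoint_mem_meshTrace_of_mem_support hPnil P.end_mem_support), by
      show a₀ ≤ φP vP; linarith⟩
  have hTDl : ∃ z ∈ TD, z.re ≤ -a₀ :=
    ⟨_, mem_image_of_mem _ ⟨_, toComplex_mem_walkTrace_of_mem_support hDnil D.start_mem_support, rfl⟩, by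
      show φD fD ≤ -a₀; linarith⟩
  have hTDr : ∃ z ∈ TD, a₀ ≤ z.re :=
    ⟨_, mem_image_of_mem _ ⟨_, toComplex_mem_walkTrace_of_mem_support hDnil D.end_mem_support, rfl⟩, by
      show a₀ ≤ φD gDend; linarith⟩
  obtain ⟨KP, hKPsub, hKPc, hKPconn, hKPre, hKPl, hKPr⟩ :=
    exists_subcontinuum_between_lines (a := -a₀) (b := a₀) (by linarith) hTPc hTPconn hTPl hTPr
  obtain ⟨KD, hKDsub, hKDc, hKDconn, hKDre, hKDl, hKDr⟩ :=
    exists_subcontinuum_between_lines (a := -a₀) (b := a₀) (by linarith) hTDc hTDconn hTDl hTDr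
  have hKPrect : KP ⊆ Icc (-a₀) a₀ ×ℂ Icc (-b₀) b₀ := by
    intro z hz
    have hb := hTPbox z (hKPsub hz)
    rw [mem_plateBox_iff_abs] at hb
    rw [mem_reProdIm, mem_Icc, mem_Icc]
    exact ⟨hKPre z hz, by constructor <;> linarith [(abs_le.1 hb.2).1, (abs_le.1 hb.2).2]⟩
  have hKDrect : KD ⊆ Icc (-a₀) a₀ ×ℂ Icc (-b₀) b₀ := by
    intro z hz
    have hb := hTDbox z (hKDsub hz)
    rw [mem_plateBox_iff_abs] at hb
    rw [mem_reProdIm, mem_Icc, mem_Icc]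
    exact ⟨hKDre z hz, by constructor <;> linarith [(abs_le.1 hb.2).1, (abs_le.1 hb.2).2]⟩
  have hKPimg : Φ '' KP ⊆ meshTrace δ P := by
    rintro _ ⟨z, hz, rfl⟩
    obtain ⟨p, hp, hpz⟩ := hKPsub hz
    rw [← hpz, Homeomorph.apply_symm_apply]; exact hp
  have hKDimg : Φ '' KD ⊆ dualScale δ '' walkTrace D := by
    rintro _ ⟨z, hz, rfl⟩
    obtain ⟨p, hp, hpz⟩ := hKDsub hz
    rw [← hpz, Homeomorph.apply_symm_apply]; exact hp
  ------------------------------------------------------------------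
  -- Step 6: the rounded loop crosses the rectangle between the two traces
  ------------------------------------------------------------------
  obtain ⟨C, hCsub, hCconn, hCl, hCr⟩ : ∃ C ⊆ Φ.symm '' range Λ ∩ Icc (-a₀) a₀ ×ℂ Icc (-b₀) b₀,
      IsPreconnected C ∧ (∃ z ∈ C, z.re = -a₀) ∧ ∃ z ∈ C, z.re = a₀ := by
    rcases hcases with ⟨hP0, hD0⟩ | ⟨hP0, hD0⟩
    · have hPin : meshTrace δ P ⊆ IsJordanLoop.inside Λ :=
        meshTrace_subset_inside_of_wind_ne_zero hq hδ hPω hyP hP0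
      have hDout : dualScale δ '' walkTrace D ⊆ IsJordanLoop.outside Λ :=
        dualTrace_subset_outside_of_wind_eq_zero hq hδ hDω hyD hD0
      exact hΛJ.exists_isPreconnected_crossing_of_separated Φ (by linarith) (by linarith)
        hKPc hKPconn hKPrect hKPl hKPr (hKPimg.trans hPin) hKDc hKDconn hKDrect hKDl hKDr (hKDimg.trans hDout)
    · have hPout : meshTrace δ P ⊆ IsJordanLoop.outside Λ :=
        meshTrace_subset_outside_of_wind_eq_zero hq hδ hPω hyP hP0
      have hDin : dualScale δ '' walkTrace D ⊆ IsJordanLoop.inside Λ :=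
        dualTrace_subset_inside_of_wind_ne_zero hq hδ hDω hyD hD0
      exact hΛJ.exists_isPreconnected_crossing_of_separated Φ (by linarith) (by linarith)
        hKDc hKDconn hKDrect hKDl hKDr (hKDimg.trans hDin) hKPc hKPconn hKPrect hKPl hKPr (hKPimg.trans hPout)
  ------------------------------------------------------------------
  -- Step 7: from the crossing piece to the arc
  ------------------------------------------------------------------
  have hCsub' : C ⊆ Φ.symm '' range Λ ∩ plateBox a₀ b₀ := by
    intro z hz
    obtain ⟨h1, h2⟩ := hCsub hz
    exact ⟨h1, by rwa [plateBox]⟩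
  obtain ⟨j₁, α, t₁, hα, hband, hleft, hright⟩ :=
    exists_arc_of_run hq hδ Φ hroom h2δρ (by linarith : a₀ ≤ 2) (by linarith : b₀ ≤ 2) hCsub' hCconn hCl hCr
  let q' := OrbitPolygon.corner ω q j₁
  have hq' : q' ∈ periodicPts (nextCorner ω) := OrbitPolygon.corner_mem_periodicPts hq j₁
  refine ⟨orbitLoop ω q', isInterfaceLoop_orbitLoop hq', ?_, α, 0, t₁, hα, t₁.2.1, ?_, ?_, ?_⟩
  · -- the window
    have hcl : ∀ y' ∈ openCluster ω q'.1, ‖meshPoint δ y'‖ < W₁ := by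
      intro y' hy'
      have hq'C : q'.1 ∈ openCluster ω q.1 := iterate_nextCorner_fst_mem_openCluster ω q j₁
      have hqW : ‖meshPoint δ q.1‖ ≤ W₀ := by rw [hqj]; exact (hShbox _ (hvsupp j hj)).le
      have hy'' : y' ∈ openCluster ω q.1 := SimpleGraph.Reachable.trans hq'C hy'
      exact norm_meshPoint_lt_of_mem_openCluster_of_not_mem_annulusOpenCrossing hωE hδ hW₀₁ hwinP hqW hy''
    refine (range_loopCurve_orbitLoop_subset_ball hq' hδ hcl).trans (ball_subset_ball ?_)
    linarith
  · intro u hu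
    refine image_mono (fun z hz ↦ ?_) (hband u hu)
    rw [mem_plateBox_iff_abs] at hz ⊢
    constructor <;> linarith [hz.1, hz.2]
  · obtain ⟨u, hu, h⟩ := hleft
    exact ⟨u, hu, mem_image_of_symm_mem (by show (Φ.symm (α u)).re ≤ -(xin - c / 2); linarith)⟩
  · obtain ⟨u, hu, h⟩ := hright
    exact ⟨u, hu, mem_image_of_symm_mem (by show xin - c / 2 ≤ (Φ.symm (α u)).re; linarith)⟩

end Summit.CriticalPhenomena.CardyFormulaZ2.Cruxes.LoopsToCrossings.OracleSandwich

end
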